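/-
Copyright: cell `pub-ymgap` (HUMAN RULING D-0062), Track A of `YM-PLAN.md`, DAG node N20 (= NE7b); R134 acceleration seat
`pub-ymgap-dag-n20-c` (strategy s1, generation 5), module 33.  Released under the licence of the surrounding project.
-/
import Summits.QuantumFields.YangMills.Theorems.BalabanUVNodesN20LCSLabelTowerSupport
import Summits.QuantumFields.YangMills.Theorems.BalabanUVNodesN20LCSLabelTowerByValue
import Summits.QuantumFields.YangMills.Theorems.BalabanUVNodesN20LCSLabelTowerPinnedLevel
import Summits.QuantumFields.YangMills.Theorems.BalabanUVNodesN20LCSLabelPieces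
import HarnessLib

/-!
# YM-DAG node N20 (= NE7b), strategy s1, module 33: FIDELITY CERTIFICATE — the label tower of record IS NODE 00's value-level T-step (†)
# (`Node00.TStepOfRecord.texpASucc`) LABEL BY LABEL: at every performed step the Haar density of a history term grown by a label `t` is, almost
# everywhere, def-T's label piece `χ_{k+1}(σ s t)·texpASucc avOfRecord χ_k (Haar density of the old term) (ω s t) (σ s t)` — «same object as
# Bałaban's (3.1) with (3.2)·(3.3)·(3.16)·(3.20) inserted» as a THEOREM, not prose

Track A of `YM-PLAN.md` (cell `pub-ymgap`, HUMAN RULING D-0062), node **N20** = spine estimate NE7b (`T4WeightBudget.RelWeightBound` — NOT PRINTED,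
NOT PROVED).  Seat `pub-ymgap-dag-n20-c` (R134, s1), generation 5, module 33 (27 object · 28 class weight · 29 by value · 30∕32 later pinned levels · 31 support).
Kernel theorems only: 0 `def`, 0 `sorry`, standard axioms; COUNT-NEUTRAL; `--supports` the K3⁗ item.  Nothing of Bałaban's is asserted.

WHY.  Module 27's honest framing says the label tower's history terms are «Bałaban's T-step label pieces divided by `dμ_j∕dHaar_j`».  A referee's A-check
(«is the object the record's?») wants that as a kernel statement against def-T's OWN definition of the step, `Node00.TStepOfRecord.texpASucc` ((†):
`(𝐓e^A)_{k+1}(s′)(V′) = ∫dU δ(ŪV′⁻¹)[w(s′)(U,V′)·χ_k(init s′)(U)·(𝐓e^A)_k(init s′)(U)]`, kernel `transportK`), whose label-resolved reading module 21 typed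
(`N20LCSLabelPieces.integral_mul_labelPiece`: the piece of the label `t` after the old sequence `s` is `χ_{k+1}(σ s t)·texpASucc avOfRecord χ_k T (ω s t) (σ s t)`).
THIS FILE proves it: the two currencies give THE SAME MEASURE on the level-`(k+1)` fields, hence the same Haar density almost everywhere.

WHAT (under the two ζ-laws, the (O4) measurability `hω` of the label weights and — def-T's own displayed proviso — the measurability of the new front
factor `χ_{k+1}(σ s t)`; performed steps `k < K`; bounded measurable `ρ₀ ≥ 0`):
* §1 `chiSeq_mul_eterm` — every history term CARRIES the front factor of its own sequence: `χ_k(seqOfHist k h)·eterm k h = eterm k h` (level `0`: `χ_0 ≡ 1`,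
  def-T's `chiSeqOfRecord_zero`; level `k+1`: module 31's `chiSeq_eq_one_of_eterm_ne_zero`).
* §2 ★★★ **`integral_mul_eterm_succ_eq_integral_mul_labelPiece`** — ONE-STEP FIDELITY IN MEASURE: for every bounded measurable test function `m` of the
  new field, `∫ m·eterm (k+1) (h,t) dμ_{k+1} = ∫ m·[χ_{k+1}(σ s t)·texpASucc avOfRecord χ_k (ρ_k^{Haar}) (ω s t) (σ s t)] dHaar_{k+1}`, where
  `s = seqOfHist k h` and `ρ_k^{Haar} = (dμ_k∕dHaar_k)·eterm k h` is the Haar density of the old term (module 29's module property `integral_mul_ofKernel_wCondKernel` on the left — ANY history `h` —, module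
  21's `integral_mul_labelPiece` on the right, module 30's Radon–Nikodym transport in between).
* §3 ★★★ **`rnDeriv_mul_eterm_succ_ae_eq_labelPiece`** — hence `(dμ_{k+1}∕dHaar_{k+1})·eterm (k+1) (h,t) = χ_{k+1}(σ s t)·texpASucc … (σ s t)`
  `Haar_{k+1}`-ALMOST EVERYWHERE (`T4AveragingDisintegration.ae_eq_of_forall_integral_mul_eq`): at every performed step the Haar density of the label
  tower's history term IS def-T's (†) label piece grown from the Haar density of its predecessor — by induction from `eterm 0 = ρ₀` (`μ_0 =` Haar),
  the label tower is NODE 00's T-step tower read label by label, up to Haar-null sets at each level.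

HONEST FRAMING.  A certificate about OBJECTS (no estimate): the identification holds in measure ∕ almost everywhere — the natural notion, both sides being
densities against which observables are integrated (def-T's VERSION CAVEAT: `transportK` is itself a version of print's `∫dU δ(ŪV⁻¹)`).  T-steps only
(the 𝐑-step (0.3) ∕ (A1c) is not in the label tower); the sequence-indexed RESUMMED weights of def-T's `tstepOfRecord` are the label weights summed over
the labels with a given new pair (def-T's `labelUnity`∕`IsStepUnity` bookkeeping), not re-derived here.  Displayed: the two ζ-laws, (O4), the front-factor
measurability.  NE7b NOT PRINTED ∕ NOT PROVED; (α)-instance 0∕1; N20 NOT discharged; typed 28∕28, discharged count untouched; one finite four-torus at fixed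
`ε` — NOT ℝ⁴, NOT infinite volume, NOT OS, NOT a mass gap, NOT Clay.

References (LOCATORS): T. Bałaban, CMP 119 (1988) 243–285 [Balaban1988Convergent] ((3.1) p. 264, (3.2)–(3.5) p. 265, (3.24)–(3.25) p. 270);
CMP 109 (1987) 249–301 [Balaban1987RG1] ((0.4) p. 253).
-/

set_option autoImplicit false

noncomputable section

open scoped BigOperators ENNReal

namespace Summit.QuantumFields.YangMills.BalabanUVNodes.N20LCSLabelTowerFidelity

open MeasureTheory
open Literature.MathematicalPhysics.QuantumFieldTheory.Balaban1983to89
open Literature.MathematicalPhysics.QuantumFieldTheory.Balaban1983to89.T4Continuum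
open Literature.MathematicalPhysics.QuantumFieldTheory.Balaban1983to89.T4AveragingDisintegration (ae_eq_of_forall_integral_mul_eq)
open Literature.MathematicalPhysics.QuantumFieldTheory.Balaban1983to89.Node00
open Summit.QuantumFields.BalabanUV.T4Continuum.B16HistoryIndexedRepr (GoodClass)
open Summit.QuantumFields.BalabanUV.T4Continuum.B16HistoryReprChain
open Summit.QuantumFields.BalabanUV.T4Continuum.NE7b.PrefixExtraction (eterm_snoc)
open Summit.QuantumFields.YangMills.BalabanUVNodes.N20LCSLabelTower
open Summit.QuantumFields.YangMills.BalabanUVNodes.N20LCSLabelTowerClassWeight (clampW_ωOfRecord)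
open Summit.QuantumFields.YangMills.BalabanUVNodes.N20LCSLabelTowerByValue (integral_mul_ofKernel_wCondKernel)
open Summit.QuantumFields.YangMills.BalabanUVNodes.N20LCSLabelTowerPinnedLevel
  (lawOfRecord_absolutelyContinuous integral_lawOfRecord_eq measurable_rnDeriv_toReal integrable_rnDeriv_mul)
open Summit.QuantumFields.YangMills.BalabanUVNodes.N20LCSLabelTowerSupport (chiSeq_eq_one_of_eterm_ne_zero)
open Summit.QuantumFields.YangMills.BalabanUVNodes.N20LCSLabelPieces (integral_mul_labelPiece abs_ωOfRecord_le_one)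

variable (F : T4Family) (N : ℕ) [NeZero N] (ν : Stage7Numerics) (M : ℕ) (p : B12.RunParams) (g : ℕ → ℝ) {A₁ : ℝ} {ζ : ZetaOfRecord F N ν M}

/-! ## §1 Every history term carries the front factor of its own sequence -/

/-- `χ_k(seqOfHist k h)·eterm k h = eterm k h` pointwise: at level `0` the front factor is `1` (`chiSeqOfRecord_zero`), one level up the history term
vanishes wherever the front factor of its sequence is not `1` (module 31). [folklore] -/
theorem chiSeq_mul_eterm
    (hω : ∀ (k : ℕ) (s : SeqOfRecord F ν M g p.K k) (t : LbOfRecord F ν p g k),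
      Measurable fun z : cfgOfRecord F N p.K (k + 1) × cfgOfRecord F N p.K k => ωOfRecord F N ν M p g k A₁ ζ s t z.2 z.1)
    (ρ₀ : cfgOfRecord F N p.K 0 → ℝ) :
    ∀ (k : ℕ) (h : Fin k → LabelPat F ν p g) (U : cfgOfRecord F N p.K k),
      chiSeqOfRecord F N ν M g p.K k (seqOfHist F ν M p g k h) U * (labelTowerOfRecord F N ν M p g A₁ ζ).eterm ρ₀ k h U =
        (labelTowerOfRecord F N ν M p g A₁ ζ).eterm ρ₀ k h U
  | 0, h, U => by rw [chiSeqOfRecord_zero, one_mul]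
  | k + 1, h, U => by
      by_cases hne : (labelTowerOfRecord F N ν M p g A₁ ζ).eterm ρ₀ (k + 1) h U = 0
      · rw [hne, mul_zero]
      · rw [chiSeq_eq_one_of_eterm_ne_zero F N ν M p g hω ρ₀ k h U hne, one_mul]

/-! ## §2 One-step fidelity in measure -/

/-- ★★★ **ONE-STEP FIDELITY IN MEASURE.**  For a performed step `k < K`, under the two ζ-laws, the (O4) measurability of the label weights and the
measurability of the new front factor `χ_{k+1}(σ s t)` (def-T's displayed proviso), for every bounded measurable `ρ₀`, history `h` of length `k`, label `t`
and every bounded measurable test function `m` of the level-`(k+1)` field: with `s = seqOfHist k h` and `ρ_k^{Haar} = (dμ_k∕dHaar_k)·eterm ρ₀ k h`,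
`∫ m·eterm ρ₀ (k+1) (h,t) dμ_{k+1} = ∫ m·(χ_{k+1}(σ s t)·texpASucc avOfRecord χ_k (fun _ => ρ_k^{Haar}) (fun _ => ω s t) (σ s t)) dHaar_{k+1}`
— the label tower's step and NODE 00's value-level T-step (†) resolved at the label `t` define THE SAME MEASURE on the new fields. [folklore] -/
theorem integral_mul_eterm_succ_eq_integral_mul_labelPiece (A₁ : ℝ) (hζu : IsZetaUnity F N ν M ζ) (hζ : IsZetaAbsLeOne F N ν M ζ)
    (hω : ∀ (k : ℕ) (s : SeqOfRecord F ν M g p.K k) (t : LbOfRecord F ν p g k),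
      Measurable fun z : cfgOfRecord F N p.K (k + 1) × cfgOfRecord F N p.K k => ωOfRecord F N ν M p g k A₁ ζ s t z.2 z.1)
    {ρ₀ : cfgOfRecord F N p.K 0 → ℝ} (hρ : (bddMeas (cfgOfRecord F N p.K 0)).Gd ρ₀) (k : ℕ) (hk : k < p.K)
    (h : Fin k → LabelPat F ν p g) (t : LbOfRecord F ν p g k)
    (hχ : Measurable (chiSeqOfRecord F N ν M g p.K (k + 1) (σOfRecord F ν M p g k (seqOfHist F ν M p g k h) t)))
    {m : cfgOfRecord F N p.K (k + 1) → ℝ} (hm : (bddMeas (cfgOfRecord F N p.K (k + 1))).Gd m) :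
    ∫ V', m V' * (labelTowerOfRecord F N ν M p g A₁ ζ).eterm ρ₀ (k + 1) (Fin.snoc h ⟨k, t⟩) V' ∂(lawOfRecord F N p.K (k + 1)) =
      ∫ V', m V' * (chiSeqOfRecord F N ν M g p.K (k + 1) (σOfRecord F ν M p g k (seqOfHist F ν M p g k h) t) V' *
          texpASucc (avOfRecord F N p.K k).avg (chiSeqOfRecord F N ν M g p.K k)
            (fun _ U => ((lawOfRecord F N p.K k).rnDeriv (fieldMeasure (F.P p.K) k (SU N)) U).toReal *
              (labelTowerOfRecord F N ν M p g A₁ ζ).eterm ρ₀ k h U)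
            (fun _ => ωOfRecord F N ν M p g k A₁ ζ (seqOfHist F ν M p g k h) t) (σOfRecord F ν M p g k (seqOfHist F ν M p g k h) t) V')
        ∂(fieldMeasure (F.P p.K) (k + 1) (SU N)) := by
  set T := labelTowerOfRecord F N ν M p g A₁ ζ with hT
  set e : cfgOfRecord F N p.K k → ℝ := T.eterm ρ₀ k h with he
  set dens : cfgOfRecord F N p.K k → ℝ := fun U => ((lawOfRecord F N p.K k).rnDeriv (fieldMeasure (F.P p.K) k (SU N)) U).toReal
    with hdens
  have hk' : k ≤ p.K := hk.le
  have hegood : (bddMeas (cfgOfRecord F N p.K k)).Gd e := T.eterm_good hρ k h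
  have heint : Integrable e (lawOfRecord F N p.K k) := integrable_of_bddMeas _ hegood
  obtain ⟨hmm, Cm, hCm⟩ := hm
  -- LEFT: the label tower's step, by the module property, is the graph integral of `m(Ū)·ω(U,Ū)·e(U)` against `μ_k` …
  have hL : ∫ V', m V' * T.eterm ρ₀ (k + 1) (Fin.snoc h ⟨k, t⟩) V' ∂(lawOfRecord F N p.K (k + 1)) =
      ∫ U, m ((avOfRecord F N p.K k).avg U) *
        (ωOfRecord F N ν M p g k A₁ ζ (seqOfHist F ν M p g k h) t U ((avOfRecord F N p.K k).avg U) * e U) ∂(lawOfRecord F N p.K k) := by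
    have e1 : ∀ V', T.eterm ρ₀ (k + 1) (Fin.snoc h ⟨k, t⟩) V' = (T.op k h ⟨k, t⟩).T e V' := fun V' => by
      rw [he, eterm_snoc]
    simp_rw [e1]
    -- the module property of the weighted conditional kernel step (module 29 §1), for ANY history `h`
    calc ∫ V', m V' * (T.op k h ⟨k, t⟩).T e V' ∂(lawOfRecord F N p.K (k + 1))
        = ∫ U, m ((avOfRecord F N p.K k).avg U) * (clampW (ωOfRecord F N ν M p g k A₁ ζ (seqOfHist F ν M p g k h)
            (labelAt F ν p g k ⟨k, t⟩) U ((avOfRecord F N p.K k).avg U)) * e U) ∂(lawOfRecord F N p.K k) := by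
          rw [lawOfRecord_succ]
          exact integral_mul_ofKernel_wCondKernel (avOfRecord_measurable F N p.K k) (hω k _ _) ⟨hmm, Cm, hCm⟩ hegood
      _ = _ := integral_congr_ae (ae_of_all _ fun U => by
            dsimp only
            rw [clampW_ωOfRecord F N ν M p g A₁ hζu hζ, labelAt_mk])
  -- … which, transported to Haar, is the graph integral of `m(Ū)·ω(U,Ū)·(dens·e)(U)` against `dHaar_k`
  have hL' : ∫ U, m ((avOfRecord F N p.K k).avg U) *
        (ωOfRecord F N ν M p g k A₁ ζ (seqOfHist F ν M p g k h) t U ((avOfRecord F N p.K k).avg U) * e U) ∂(lawOfRecord F N p.K k) =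
      ∫ U, m ((avOfRecord F N p.K k).avg U) * ωOfRecord F N ν M p g k A₁ ζ (seqOfHist F ν M p g k h) t U ((avOfRecord F N p.K k).avg U) *
        (chiSeqOfRecord F N ν M g p.K k (seqOfHist F ν M p g k h) U * (dens U * e U)) ∂(fieldMeasure (F.P p.K) k (SU N)) := by
    rw [integral_lawOfRecord_eq F N p.K k hk']
    refine integral_congr_ae (ae_of_all _ fun U => ?_)
    have hce := chiSeq_mul_eterm F N ν M p g hω ρ₀ k h U
    show dens U * (m _ * (_ * e U)) = m _ * _ * (chiSeqOfRecord F N ν M g p.K k (seqOfHist F ν M p g k h) U * (dens U * e U))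
    calc dens U * (m ((avOfRecord F N p.K k).avg U) *
            (ωOfRecord F N ν M p g k A₁ ζ (seqOfHist F ν M p g k h) t U ((avOfRecord F N p.K k).avg U) * e U))
        = m ((avOfRecord F N p.K k).avg U) * ωOfRecord F N ν M p g k A₁ ζ (seqOfHist F ν M p g k h) t U ((avOfRecord F N p.K k).avg U) *
            (dens U * (chiSeqOfRecord F N ν M g p.K k (seqOfHist F ν M p g k h) U * e U)) := by rw [hce]; ring
      _ = _ := by ring
  -- RIGHT: module 21's graph identity for def-T's label piece grown from the Haar state `dens·e`
  have hTint : Integrable (fun U => chiSeqOfRecord F N ν M g p.K k (seqOfHist F ν M p g k h) U * (dens U * e U))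
      (fieldMeasure (F.P p.K) k (SU N)) := by
    have hi := integrable_rnDeriv_mul F N p.K k hk' heint
    refine hi.congr (ae_of_all _ fun U => ?_)
    have hce := chiSeq_mul_eterm F N ν M p g hω ρ₀ k h U
    show dens U * e U = chiSeqOfRecord F N ν M g p.K k (seqOfHist F ν M p g k h) U * (dens U * e U)
    calc dens U * e U = dens U * (chiSeqOfRecord F N ν M g p.K k (seqOfHist F ν M p g k h) U * e U) := by rw [hce]
      _ = _ := by ring
  have hR := integral_mul_labelPiece F N ν M p g k hk A₁ hζ (fun _ U => dens U * e U) (seqOfHist F ν M p g k h) t hTint (hω k _ t) hχ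
    hmm hCm
  rw [hL, hL', ← hR]

/-! ## §3 Hence almost everywhere: the Haar density of the history term IS def-T's label piece -/

/-- ★★★ **THE LABEL TOWER IS NODE 00's T-STEP (†), LABEL BY LABEL, ALMOST EVERYWHERE.**  With the hypotheses of §2 and `k + 1 ≤ K`: the Haar density of the
label tower's level-`(k+1)` history term grown by the label `t`,
`(dμ_{k+1}∕dHaar_{k+1})·eterm ρ₀ (k+1) (h,t) = χ_{k+1}(σ s t)·texpASucc avOfRecord χ_k (fun _ => (dμ_k∕dHaar_k)·eterm ρ₀ k h) (fun _ => ω s t) (σ s t)`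
`Haar_{k+1}`-almost everywhere — def-T's value-level T-step of the old term's Haar density, resolved at the label. [folklore] -/
theorem rnDeriv_mul_eterm_succ_ae_eq_labelPiece (A₁ : ℝ) (hζu : IsZetaUnity F N ν M ζ) (hζ : IsZetaAbsLeOne F N ν M ζ)
    (hω : ∀ (k : ℕ) (s : SeqOfRecord F ν M g p.K k) (t : LbOfRecord F ν p g k),
      Measurable fun z : cfgOfRecord F N p.K (k + 1) × cfgOfRecord F N p.K k => ωOfRecord F N ν M p g k A₁ ζ s t z.2 z.1)
    {ρ₀ : cfgOfRecord F N p.K 0 → ℝ} (hρ : (bddMeas (cfgOfRecord F N p.K 0)).Gd ρ₀) (k : ℕ) (hk : k < p.K)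
    (h : Fin k → LabelPat F ν p g) (t : LbOfRecord F ν p g k)
    (hχ : Measurable (chiSeqOfRecord F N ν M g p.K (k + 1) (σOfRecord F ν M p g k (seqOfHist F ν M p g k h) t))) :
    (fun V' => ((lawOfRecord F N p.K (k + 1)).rnDeriv (fieldMeasure (F.P p.K) (k + 1) (SU N)) V').toReal *
        (labelTowerOfRecord F N ν M p g A₁ ζ).eterm ρ₀ (k + 1) (Fin.snoc h ⟨k, t⟩) V') =ᵐ[fieldMeasure (F.P p.K) (k + 1) (SU N)]
      fun V' => chiSeqOfRecord F N ν M g p.K (k + 1) (σOfRecord F ν M p g k (seqOfHist F ν M p g k h) t) V' *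
          texpASucc (avOfRecord F N p.K k).avg (chiSeqOfRecord F N ν M g p.K k)
            (fun _ U => ((lawOfRecord F N p.K k).rnDeriv (fieldMeasure (F.P p.K) k (SU N)) U).toReal *
              (labelTowerOfRecord F N ν M p g A₁ ζ).eterm ρ₀ k h U)
            (fun _ => ωOfRecord F N ν M p g k A₁ ζ (seqOfHist F ν M p g k h) t) (σOfRecord F ν M p g k (seqOfHist F ν M p g k h) t) V' := by
  set T := labelTowerOfRecord F N ν M p g A₁ ζ with hT
  have hk1 : k + 1 ≤ p.K := hk
  -- both sides are Haar-integrable densities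
  have h1 : Integrable (fun V' => ((lawOfRecord F N p.K (k + 1)).rnDeriv (fieldMeasure (F.P p.K) (k + 1) (SU N)) V').toReal *
      T.eterm ρ₀ (k + 1) (Fin.snoc h ⟨k, t⟩) V') (fieldMeasure (F.P p.K) (k + 1) (SU N)) :=
    integrable_rnDeriv_mul F N p.K (k + 1) hk1 (integrable_of_bddMeas _ (T.eterm_good hρ (k + 1) _))
  have heint : Integrable (T.eterm ρ₀ k h) (lawOfRecord F N p.K k) := integrable_of_bddMeas _ (T.eterm_good hρ k h)
  have hTint : Integrable (fun U => chiSeqOfRecord F N ν M g p.K k (seqOfHist F ν M p g k h) U *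
      (((lawOfRecord F N p.K k).rnDeriv (fieldMeasure (F.P p.K) k (SU N)) U).toReal * T.eterm ρ₀ k h U)) (fieldMeasure (F.P p.K) k (SU N)) := by
    refine (integrable_rnDeriv_mul F N p.K k hk.le heint).congr (ae_of_all _ fun U => ?_)
    have hce := chiSeq_mul_eterm F N ν M p g hω ρ₀ k h U
    show _ * T.eterm ρ₀ k h U = chiSeqOfRecord F N ν M g p.K k (seqOfHist F ν M p g k h) U * (_ * T.eterm ρ₀ k h U)
    calc ((lawOfRecord F N p.K k).rnDeriv (fieldMeasure (F.P p.K) k (SU N)) U).toReal * T.eterm ρ₀ k h U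
        = ((lawOfRecord F N p.K k).rnDeriv (fieldMeasure (F.P p.K) k (SU N)) U).toReal *
            (chiSeqOfRecord F N ν M g p.K k (seqOfHist F ν M p g k h) U * T.eterm ρ₀ k h U) := by rw [hce]
      _ = _ := by ring
  have h2 := integrable_piece_texpASucc (avOfRecord_measurable F N p.K k) (avOfRecord_haarAC F N p.K k hk)
    (chiSeqOfRecord F N ν M g p.K k)
    (fun _ U => ((lawOfRecord F N p.K k).rnDeriv (fieldMeasure (F.P p.K) k (SU N)) U).toReal * T.eterm ρ₀ k h U)
    (chiSeqOfRecord F N ν M g p.K (k + 1)) (fun _ => ωOfRecord F N ν M p g k A₁ ζ (seqOfHist F ν M p g k h) t)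
    (σOfRecord F ν M p g k (seqOfHist F ν M p g k h) t) (by simpa only [init_σOfRecord] using hTint) (hω k _ t)
    (fun U V' => abs_ωOfRecord_le_one F N ν M p g k A₁ hζ _ t U V') hχ (fun V' => abs_chiSeqOfRecord_le_one F N ν M g p.K (k + 1) _ V')
  refine ae_eq_of_forall_integral_mul_eq h1 h2 fun f hf hfC => ?_
  obtain ⟨C, hC⟩ := hfC
  -- test against `f`: transport the left to `μ_{k+1}` and use §2
  have hl : ∫ V', ((lawOfRecord F N p.K (k + 1)).rnDeriv (fieldMeasure (F.P p.K) (k + 1) (SU N)) V').toReal *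
        T.eterm ρ₀ (k + 1) (Fin.snoc h ⟨k, t⟩) V' * f V' ∂(fieldMeasure (F.P p.K) (k + 1) (SU N)) =
      ∫ V', f V' * T.eterm ρ₀ (k + 1) (Fin.snoc h ⟨k, t⟩) V' ∂(lawOfRecord F N p.K (k + 1)) := by
    rw [integral_lawOfRecord_eq F N p.K (k + 1) hk1]
    exact integral_congr_ae (ae_of_all _ fun V' => by ring)
  rw [hl, integral_mul_eterm_succ_eq_integral_mul_labelPiece F N ν M p g A₁ hζu hζ hω hρ k hk h t hχ ⟨hf, C, hC⟩]
  exact integral_congr_ae (ae_of_all _ fun V' => by ring)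

end Summit.QuantumFields.YangMills.BalabanUVNodes.N20LCSLabelTowerFidelity

end
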